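import Literature.Analysis.FluidPDE.AncientAxisymFarFieldFlattening
import Literature.Analysis.FluidPDE.LeiRenZhang2019Liouville
import HarnessLib

/-!
# Lei–Ren–Zhang 2019, Lemma 5.1 (i): bounded ancient axisymmetric solutions with bounded swirl
# converge to constant vectors on balls sliding to infinity

Analysis/FluidPDE **proofs file** (theorems only: no definitions, no named facts, no `sorry`) on
the discharge path of the named fact `Literature.Analysis.FluidPDE.leiRenZhang2019_sliding`
(`LeiRenZhang2019PeriodicLiouville`; Z. Lei, X. Ren, Q. S. Zhang, arXiv:1902.11229, §5 **Lemma 5.1**,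
p. 13, "Sliding Property"; the receding-axis argument is also Case 2 of the proof of Theorem 1.4
of Z. Lei, Q. S. Zhang, J. Funct. Anal. 261 (2011) = arXiv:1011.5066, §4, pp. 12–13). The fact is
the conjunction of a velocity
statement (i) and a swirl statement (ii); this file proves **(i) verbatim**, for the tree's
duality-form bounded ancient mild solutions with measurable axisymmetric slices and bounded swirl:

* `IsBoundedWeakNSSolutionOn.congr_ae` — KNSS's bounded weak class (§4 (ii)) is invariant under
  jointly measurable bounded modifications `v` with `v(t) = u(t)` a.e. for a.e. `t`;
* `IsBoundedAncientMildSolution.exists_ae_eq_add_const_slice` — **from a.e. `t` to every `t`**: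
  if a bounded ancient mild solution `u` (duality form) satisfies `u(t) = U(t) + c(t)` a.e. for
  a.e. `t < 0`, with `U` bounded, Lipschitz in time and weakly divergence free, then for **every**
  `t < 0`, `u(t) = U(t) + c'` a.e. for some constant `c'` (the solenoidal pairings of `u` and of
  `U` are continuous in `t`, constants pair to zero with solenoidal tests, and a bounded weakly
  divergence-free field annihilating the solenoidal tests is a.e. constant — KNSS Lemma 3.1 in the
  form `IsWeaklyDivFree.exists_ae_eq_const_of_norm_le_of_forall_integral_inner_eq_zero`);
* `leiRenZhang2019_sliding_velocity` — for such `u` and all `R, ε > 0` there is `ρ` with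
  `‖u(t, x) − u(t, y)‖ ≤ ε` for a.e. `x, y ∈ B(x₀, R)`, for every `t < 0` and every centre with
  `r(x₀) ≥ ρ`; `leiRenZhang2019_sliding_velocity_cubes` is conjunct (i) of the fact as printed
  (parabolic cubes `Q_R(t₀, x₀)`, `t₀ ≤ 0`).

Proof of the main theorem (LRZ19 p. 13, through KNSS 2009): the class bridge
`exists_jointly_measurable_axial_modification` gives a jointly measurable modification `ũ` of `u`
up to a slice-wise axial drift, a bounded weak solution
(`IsBoundedAncientMildSolution.isBoundedWeakNSSolutionOn`); KNSS §4 with the swirl normalisation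
(`KNSS2009_regularity_axisymmetric_swirl_holds`) writes `ũ = U + β(t)e_z` a.e. with `U` smooth,
axisymmetric, with bounded derivatives, Lipschitz in time; by `exists_ae_eq_add_const_slice` and
axisymmetry every slice of `u` is `U(t) +` an axial constant, so the swirl bound passes to `U`
and differences `u(t, x) − u(t, y)` are those of `U`; and `U` flattens far from the axis uniformly
in `t < 0` by `farField_velocity_osc_of_axisymmetric_add_drift` (`AncientAxisymFarFieldFlattening`:
Arzelà–Ascoli for translates, receding axes, KNSS's planar Liouville theorem).

Conjunct (ii) (oscillation of `Γ` on parabolic cubes) needs the interior gradient estimate for the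
swirl equation `∂ₜΓ + b·∇Γ + (2/r)∂ᵣΓ = ΔΓ` and is not proved here.

## Mathlib / tree search

Tree: `exists_jointly_measurable_axial_modification`, `isAxisymmetric_add_smul_eZ`,
`swirl_add_smul_eZ`, `measurePreserving_rotZ`, `eq_smul_eZ_of_ae_eq_const_of_isAxisymmetric`,
`SereginSverak2009.forall_le_of_ae_le_of_continuousOn`, `contDiff_swirl`
(`LeiRenZhang2019Liouville` and its imports); `KNSS2009_regularity_axisymmetric_swirl_holds`
(`KNSSThm53OfWindow`); `IsBoundedAncientMildSolution.continuousOn_integral_inner`,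
`integrable_inner_of_aestronglyMeasurable_of_norm_le` (`AncientMildPairing`);
`integral_inner_const_eq_zero_of_isDivFree` (`KNSSAxisymmetricNoSwirl`);
`IsWeaklyDivFree.exists_ae_eq_const_of_norm_le_of_forall_integral_inner_eq_zero`
(`BoundedAnnihilator`); `IsWeaklyDivFree.sub_of_locallyIntegrable`, `IsWeaklyDivFree.congr_ae`
(`SolenoidalL2Duality`); `continuousOn_of_norm_sub_le_mul`,
`norm_sub_eq_norm_iteratedFDeriv_zero_sub` (`KNSSRegularityGluing`);
`eq_of_ae_restrict_Iio_of_continuousOn` (`KNSSThm52Assembly`);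
`farField_velocity_osc_of_axisymmetric_add_drift` (`AncientAxisymFarFieldFlattening`). Mathlib:
`norm_iteratedFDeriv_zero`, `norm_iteratedFDeriv_one`,
`Convex.norm_image_sub_le_of_norm_fderiv_le`, `memLp_top_of_bound`.

## References

* Z. Lei, X. Ren, Q. S. Zhang, *On ancient periodic solutions to axially-symmetric Navier–Stokes
  equations*, arXiv:1902.11229 (§§1–3 and §5 published in Math. Ann. 383 (2022) 415–431), §5,
  Lemma 5.1 "Sliding Property" and its proof (arXiv p. 13). [LeiRenZhang2019]
* Z. Lei, Q. S. Zhang, *A Liouville theorem for the axially-symmetric Navier–Stokes equations*,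
  J. Funct. Anal. 261 (2011) 2323–2345 = arXiv:1011.5066, proof of Theorem 1.4, §4, Case 2
  (arXiv pp. 12–13). [LeiZhang2011]
* G. Koch, N. Nadirashvili, G. Seregin, V. Šverák, Acta Math. 203 (2009) 83–105 =
  arXiv:0709.3599: §1 p. 3 (parasitic solutions), Lemma 3.1 p. 7, §4 p. 8, Thm 5.1 p. 9.
  [KochNadirashviliSereginSverak2009]
-/

noncomputable section

open MeasureTheory Set Function Filter TopologicalSpace Metric WithLp
open _root_.Topology
open scoped RealInnerProductSpace NNReal ENNReal ContDiff

namespace Literature.Analysis.FluidPDE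

/-! ### The bounded weak class is invariant under a.e. modification -/

section CongrAe

variable {E : Type*} [NormedAddCommGroup E] [InnerProductSpace ℝ E] [FiniteDimensional ℝ E]
  [MeasurableSpace E] [BorelSpace E]

/-- **KNSS's bounded weak class only sees `u` almost everywhere on the slab** (§4 (ii), arXiv
p. 8: `u ∈ L^∞`): if `u` is a bounded weak solution on `ℝⁿ × I` and `v` is jointly a.e. strongly
measurable on the slab, pointwise bounded at the times of `I`, and `v(t) = u(t)` a.e. for a.e.
`t ∈ I`, then `v` is a bounded weak solution on `ℝⁿ × I` (the divergence constraint and the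
weak identity are integrals of the slices). [cite: KochNadirashviliSereginSverak2009, §4 (ii) (arXiv p. 8)] -/
theorem IsBoundedWeakNSSolutionOn.congr_ae {I : Set ℝ} {hI : IsOpen I} {ν : ℝ} {u v : ℝ → E → E}
    (h : IsBoundedWeakNSSolutionOn I hI ν u)
    (hvm : AEStronglyMeasurable (uncurry v) (volume.restrict (I ×ˢ univ)))
    (hvb : IsBoundedOn I v)
    (hae : ∀ᵐ t ∂((volume : Measure ℝ).restrict I), v t =ᵐ[volume] u t) :
    IsBoundedWeakNSSolutionOn I hI ν v := by
  obtain ⟨-, -, hdiv, hweak⟩ := h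
  refine ⟨hvm, hvb, ?_, fun ψ hψ hψd => ?_⟩
  · filter_upwards [hdiv, hae] with t ht hvt
    exact ht.congr_ae hvt.symm
  · rw [← hweak ψ hψ hψd]
    refine integral_congr_ae ?_
    filter_upwards [hae] with t hvt
    refine integral_congr_ae ?_
    filter_upwards [hvt] with x hx
    simp only [convect, hx]

end CongrAe

/-! ### From a.e. `t` to every `t`: slices of a bounded ancient mild solution modulo `U` -/

section EverySlice

variable {E : Type*} [NormedAddCommGroup E] [InnerProductSpace ℝ E] [FiniteDimensional ℝ E]
  [MeasurableSpace E] [BorelSpace E]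

/-- **Every slice of a bounded ancient mild solution is its regular representative plus a
constant, if almost every slice is.** Let `u` be a bounded ancient mild solution (duality form,
`0 < ν`) with measurable slices, and `U` a field with measurable slices, `‖U‖ ≤ M`,
`‖U(t, x) − U(s, x)‖ ≤ L|t − s|` and weakly divergence-free slices for `s, t < 0`, such that
`u(t) = U(t) + c(t)` a.e. for a.e. `t < 0`. Then for **every** `t < 0` there is a constant `c'`
with `u(t) = U(t) + c'` a.e.: for a solenoidal test field `φ`, `t ↦ ∫⟪u(t), φ⟫` is continuous on
`(−∞, 0)` (the duality identity, `IsBoundedAncientMildSolution.continuousOn_integral_inner`) and so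
is `t ↦ ∫⟪U(t), φ⟫`; their difference vanishes for a.e. `t` since constants pair to zero with
`φ` (KNSS §1 p. 3: the parasitic solutions `b(t)` are invisible), hence for every `t`; and a
bounded weakly divergence-free field annihilating all solenoidal test fields is a.e. constant
(KNSS Lemma 3.1, `IsWeaklyDivFree.exists_ae_eq_const_of_norm_le_of_forall_integral_inner_eq_zero`). [cite: KochNadirashviliSereginSverak2009, §1 p. 3 and Lemma 3.1 (arXiv p. 7)] -/
theorem IsBoundedAncientMildSolution.exists_ae_eq_add_const_slice {ν : ℝ} {u U : ℝ → E → E}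
    (hu : IsBoundedAncientMildSolution ν u) (hν : 0 < ν)
    (hmeas : ∀ t < 0, AEStronglyMeasurable (u t) volume)
    (hUm : ∀ t < 0, AEStronglyMeasurable (U t) volume)
    {M : ℝ} (hUM : ∀ t < 0, ∀ x, ‖U t x‖ ≤ M)
    {L : ℝ} (hUt : ∀ s < 0, ∀ t < 0, ∀ x, ‖U t x - U s x‖ ≤ L * |t - s|)
    (hUdiv : ∀ t < 0, IsWeaklyDivFree (U t)) {c : ℝ → E}
    (hae : ∀ᵐ t ∂((volume : Measure ℝ).restrict (Iio 0)), u t =ᵐ[volume] fun x => U t x + c t) :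
    ∀ t < 0, ∃ c' : E, u t =ᵐ[volume] fun x => U t x + c' := by
  obtain ⟨Mu, hMu'⟩ := hu.2
  have hMu : ∀ t < 0, ∀ x, ‖u t x‖ ≤ Mu := fun t ht x => hMu' t ht x
  -- Step 1: the solenoidal pairings of `u(t) − U(t)` vanish for every `t < 0`
  have horth : ∀ {φ : E → E}, FunctionSpaces.IsTestFunctionOn (⊤ : Opens E) φ →
      VectorCalculus.IsDivFree φ →
      ∀ t < 0, (∫ x, ⟪u t x, φ x⟫) - ∫ x, ⟪U t x, φ x⟫ = 0 := by
    intro φ hφ hdiv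
    have hφi : Integrable φ :=
      hφ.contDiff.continuous.integrable_of_hasCompactSupport hφ.hasCompactSupport
    have hφ1 : ContDiff ℝ 1 φ := hφ.contDiff.of_le (by exact_mod_cast le_top)
    have iU : ∀ t < 0, Integrable fun x => ⟪U t x, φ x⟫ := fun t ht =>
      integrable_inner_of_aestronglyMeasurable_of_norm_le (hUm t ht) (hUM t ht) hφi
    have hcu : ContinuousOn (fun t => ∫ x, ⟪u t x, φ x⟫) (Iio 0) :=
      hu.continuousOn_integral_inner hν hmeas hφ hdiv
    have hcU : ContinuousOn (fun t => ∫ x, ⟪U t x, φ x⟫) (Iio 0) := by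
      refine continuousOn_of_norm_sub_le_mul (L := L * ∫ x, ‖φ x‖) fun s hs t ht => ?_
      rw [← integral_sub (iU t ht) (iU s hs)]
      simp_rw [← inner_sub_left]
      calc ‖∫ x, ⟪U t x - U s x, φ x⟫‖ ≤ ∫ x, L * |t - s| * ‖φ x‖ :=
            norm_integral_le_of_norm_le (hφi.norm.const_mul _) (Eventually.of_forall fun x =>
              (norm_inner_le_norm _ _).trans
                (mul_le_mul_of_nonneg_right (hUt s hs t ht x) (norm_nonneg _)))
        _ = L * (∫ x, ‖φ x‖) * |t - s| := by rw [integral_const_mul]; ring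
    have hg : ContinuousOn (fun t => (∫ x, ⟪u t x, φ x⟫) - ∫ x, ⟪U t x, φ x⟫) (Iio 0) :=
      hcu.sub hcU
    have hgae : ∀ᵐ t ∂((volume : Measure ℝ).restrict (Iio 0)),
        (∫ x, ⟪u t x, φ x⟫) - ∫ x, ⟪U t x, φ x⟫ = 0 := by
      filter_upwards [hae, ae_restrict_mem measurableSet_Iio] with t ht htI
      have htI : t < 0 := htI
      have ic : Integrable fun x => ⟪c t, φ x⟫ :=
        integrable_inner_of_aestronglyMeasurable_of_norm_le aestronglyMeasurable_const
          (fun _ => le_rfl) hφi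
      have h1 : ∫ x, ⟪u t x, φ x⟫ = ∫ x, (⟪U t x, φ x⟫ + ⟪c t, φ x⟫) :=
        integral_congr_ae (by
          filter_upwards [ht] with x hx
          rw [hx, inner_add_left])
      rw [h1, integral_add (iU t htI) ic,
        integral_inner_const_eq_zero_of_isDivFree (c t) hφ1 hφ.hasCompactSupport hdiv]
      ring
    exact fun t ht => eq_of_ae_restrict_Iio_of_continuousOn hg hgae ht
  -- Step 2: `u(t) − U(t)` is bounded, weakly divergence free and annihilates solenoidal tests
  intro t ht
  have hwm : AEStronglyMeasurable (fun x => u t x - U t x) volume := (hmeas t ht).sub (hUm t ht)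
  have hwM : ∀ x, ‖u t x - U t x‖ ≤ Mu + M := fun x =>
    (norm_sub_le _ _).trans (add_le_add (hMu t ht x) (hUM t ht x))
  have hli : ∀ (v : E → E) (C : ℝ), AEStronglyMeasurable v volume → (∀ x, ‖v x‖ ≤ C) →
      LocallyIntegrable v volume := fun v C hv hC =>
    (memLp_top_of_bound hv C (Eventually.of_forall hC)).locallyIntegrable le_top
  have hwdiv : IsWeaklyDivFree (fun x => u t x - U t x) :=
    (hu.1.1 t ht).sub_of_locallyIntegrable (hUdiv t ht) (hli _ _ (hmeas t ht) (hMu t ht))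
      (hli _ _ (hUm t ht) (hUM t ht))
  have hpair : ∀ φ : E → E, FunctionSpaces.IsTestFunctionOn (⊤ : Opens E) φ →
      VectorCalculus.IsDivFree φ → ∫ x, ⟪u t x - U t x, φ x⟫ = 0 := by
    intro φ hφ hdiv
    have hφi : Integrable φ :=
      hφ.contDiff.continuous.integrable_of_hasCompactSupport hφ.hasCompactSupport
    simp_rw [inner_sub_left]
    rw [integral_sub (integrable_inner_of_aestronglyMeasurable_of_norm_le (hmeas t ht) (hMu t ht) hφi)
      (integrable_inner_of_aestronglyMeasurable_of_norm_le (hUm t ht) (hUM t ht) hφi)]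
    exact horth hφ hdiv t ht
  obtain ⟨c', hc'⟩ :=
    IsWeaklyDivFree.exists_ae_eq_const_of_norm_le_of_forall_integral_inner_eq_zero hwm hwM hwdiv
      hpair
  refine ⟨c', ?_⟩
  filter_upwards [hc'] with x hx
  exact sub_eq_iff_eq_add'.1 hx

end EverySlice

/-! ### Lemma 5.1 (i) for the duality class -/

section Sliding

/-- **Lei–Ren–Zhang 2019, Lemma 5.1 "Sliding Property", (i), velocity part, on balls.** Let `u` be a bounded ancient mild solution of the
axisymmetric Navier–Stokes equations (`ν = 1`, duality form) with measurable, pointwise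
axisymmetric slices and bounded swirl `|Γ| = |r v_θ| ≤ C`. Then for all `R, ε > 0` there is `ρ`
such that for every `t < 0` and every centre `x₀` with `r(x₀) ≥ ρ`,
`‖u(t, x) − u(t, y)‖ ≤ ε` for a.e. `x, y ∈ B(x₀, R)` ("bounded ancient solutions converge to
constants … after a sequence of translation of the space variables that slides to infinity",
LRZ19 Lemma 5.1). Proof: module docstring. [cite: LeiRenZhang2019, Lemma 5.1 and its proof (arXiv p. 13); LeiZhang2011, proof of Thm 1.4, §4 Case 2 (arXiv pp. 12–13)] -/
theorem leiRenZhang2019_sliding_velocity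
    {u : ℝ → EuclideanSpace ℝ (Fin 3) → EuclideanSpace ℝ (Fin 3)}
    (hu : IsBoundedAncientMildSolution 1 u)
    (hmeas : ∀ t < 0, AEStronglyMeasurable (u t) volume)
    (haxi : ∀ t < 0, IsAxisymmetric (u t))
    (hswirl : ∃ C : ℝ, ∀ t < 0, ∀ x, |swirl (u t) x| ≤ C)
    {R : ℝ} (hR : 0 < R) {ε : ℝ} (hε : 0 < ε) :
    ∃ ρ : ℝ, ∀ t < 0, ∀ x₀ : EuclideanSpace ℝ (Fin 3), ρ ≤ cylRadius x₀ →
      ∀ᵐ x ∂(volume : Measure (EuclideanSpace ℝ (Fin 3))),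
        ∀ᵐ y ∂(volume : Measure (EuclideanSpace ℝ (Fin 3))),
          x ∈ ball x₀ R → y ∈ ball x₀ R → ‖u t x - u t y‖ ≤ ε := by
  obtain ⟨Csw, hCsw⟩ := hswirl
  have hν : (0 : ℝ) < 1 := one_pos
  -- the class bridge
  obtain ⟨ũ, e, hũsol, hũjoint, hũsl, hũU⟩ :=
    exists_jointly_measurable_axial_modification hu hmeas haxi
  have hweak : IsBoundedWeakNSSolutionOn (Iio 0) isOpen_Iio 1 ũ :=
    hũsol.isBoundedWeakNSSolutionOn hν hũjoint hũsl
  have haxiU : ∀ t < 0, IsAxisymmetric fun x => u t x + e t • eZ := fun t ht =>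
    isAxisymmetric_add_smul_eZ (haxi t ht) _
  have hax : ∀ θ : ℝ, ∀ᵐ t ∂((volume : Measure ℝ).restrict (Iio 0)),
      (fun x => ũ t (rotZ θ x)) =ᵐ[volume] fun x => rotZ θ (ũ t x) := by
    intro θ
    filter_upwards [ae_restrict_mem measurableSet_Iio] with t ht
    have e1 : (fun x => ũ t (rotZ θ x)) =ᵐ[volume] fun x => u t (rotZ θ x) + e t • eZ :=
      (measurePreserving_rotZ θ).quasiMeasurePreserving.ae (hũU t ht)
    have e2 : (fun x => rotZ θ (ũ t x)) =ᵐ[volume] fun x => rotZ θ (u t x + e t • eZ) := by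
      filter_upwards [hũU t ht] with x hx
      simp only [hx]
    have e3 : (fun x => u t (rotZ θ x) + e t • eZ) =ᵐ[volume]
        fun x => rotZ θ (u t x + e t • eZ) :=
      Eventually.of_forall fun x => haxiU t ht θ x
    exact e1.trans (e3.trans e2.symm)
  -- KNSS §4: the regular representative `U + β(t) e_z` of `ũ`
  obtain ⟨U, β, hβm, ⟨Cβ, hβC⟩, hUjm, hrep, hsm, hdivU, haxU, hbdU, hlipU, -⟩ :=
    KNSS2009_regularity_axisymmetric_swirl_holds hweak hax
  obtain ⟨M0, hM0'⟩ := hbdU 0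
  have hUM : ∀ t < 0, ∀ x, ‖U t x‖ ≤ M0 := fun t ht x => by
    have h := hM0' t ht x
    rwa [norm_iteratedFDeriv_zero] at h
  have hU1 : ∀ t < 0, ContDiff ℝ 1 (U t) := fun t ht =>
    (hsm t ht).of_le (by exact_mod_cast le_top)
  obtain ⟨M1, hM1'⟩ := hbdU 1
  have hUx : ∀ t < 0, ∀ x y, ‖U t x - U t y‖ ≤ M1 * ‖x - y‖ := by
    intro t ht x y
    have hd : ∀ z ∈ (univ : Set (EuclideanSpace ℝ (Fin 3))), DifferentiableAt ℝ (U t) z :=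
      fun z _ => (hU1 t ht).differentiable one_ne_zero z
    have hb : ∀ z ∈ (univ : Set (EuclideanSpace ℝ (Fin 3))), ‖fderiv ℝ (U t) z‖ ≤ M1 :=
      fun z _ => by
        have h := hM1' t ht z
        rwa [norm_iteratedFDeriv_one] at h
    exact convex_univ.norm_image_sub_le_of_norm_fderiv_le hd hb (mem_univ y) (mem_univ x)
  obtain ⟨L0, hL0'⟩ := hlipU 0
  have hUt : ∀ s < 0, ∀ t < 0, ∀ x, ‖U t x - U s x‖ ≤ L0 * |t - s| := fun s hs t ht x => by
    rw [norm_sub_eq_norm_iteratedFDeriv_zero_sub]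
    exact hL0' s hs t ht x
  have hUwdiv : ∀ t < 0, IsWeaklyDivFree (U t) := fun t ht =>
    VectorCalculus.IsDivFree.isWeaklyDivFree_holds (hdivU t ht) (hU1 t ht)
  have hUc : ∀ t < 0, Continuous (U t) := fun t ht => (hsm t ht).continuous
  -- the representative is itself a bounded weak solution
  have hsolU : IsBoundedWeakNSSolutionOn (Iio 0) isOpen_Iio 1 (fun t x => U t x + β t • eZ) := by
    refine hweak.congr_ae ?_ ⟨M0 + Cβ * ‖(eZ : EuclideanSpace ℝ (Fin 3))‖, fun t ht x => ?_⟩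
      (hrep.mono fun t h => h.symm)
    · have hm : Measurable (uncurry fun t (x : EuclideanSpace ℝ (Fin 3)) => U t x + β t • eZ) :=
        hUjm.add ((hβm.comp measurable_fst).smul_const _)
      exact hm.aestronglyMeasurable
    · calc ‖U t x + β t • eZ‖ ≤ ‖U t x‖ + ‖β t • eZ‖ := norm_add_le _ _
        _ ≤ M0 + Cβ * ‖(eZ : EuclideanSpace ℝ (Fin 3))‖ := by
            rw [norm_smul, Real.norm_eq_abs]
            exact add_le_add (hUM t ht x) (mul_le_mul_of_nonneg_right (hβC t) (norm_nonneg _))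
  -- every slice of `u` is `U(t)` plus an axial constant
  have hslice : ∀ t < 0, ∃ c' : EuclideanSpace ℝ (Fin 3), ũ t =ᵐ[volume] fun x => U t x + c' :=
    hũsol.exists_ae_eq_add_const_slice hν hũsl (fun t ht => (hUc t ht).aestronglyMeasurable)
      hUM hUt hUwdiv (c := fun t => β t • eZ) hrep
  have hslice_u : ∀ t < 0, ∃ a : ℝ, u t =ᵐ[volume] fun x => U t x + a • eZ := by
    intro t ht
    obtain ⟨c', hc'⟩ := hslice t ht
    have h1 : u t =ᵐ[volume] fun x => U t x + (c' - e t • eZ) := by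
      filter_upwards [hũU t ht, hc'] with x hx hx'
      have hux : u t x = ũ t x - e t • eZ := by rw [hx, add_sub_cancel_right]
      rw [hux, hx', add_sub_assoc]
    have hw : IsAxisymmetric fun x => u t x - U t x := by
      intro θ x
      show u t (rotZ θ x) - U t (rotZ θ x) = rotZ θ (u t x - U t x)
      rw [haxi t ht θ x, haxU t ht θ x, ← rotZL_apply, ← rotZL_apply, ← rotZL_apply, map_sub]
    have hwd : (fun x => u t x - U t x) =ᵐ[volume] fun _ => c' - e t • eZ := by
      filter_upwards [h1] with x hx
      rw [hx, add_sub_cancel_left]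
    have hdax := eq_smul_eZ_of_ae_eq_const_of_isAxisymmetric hw hwd
    refine ⟨(c' - e t • eZ) 2, ?_⟩
    rw [← hdax]
    exact h1
  -- the swirl bound passes to `U`, at every `t < 0` and every `x`
  have hswU : ∀ t < 0, ∀ x, |swirl (U t) x| ≤ Csw := by
    intro t ht
    obtain ⟨a, ha⟩ := hslice_u t ht
    have hae' : ∀ᵐ x ∂(volume : Measure (EuclideanSpace ℝ (Fin 3))), |swirl (U t) x| ≤ Csw := by
      filter_upwards [ha] with x hx
      have e1 : swirl (U t) x = swirl (fun y => U t y + a • eZ) x := (swirl_add_smul_eZ (U t) a x).symm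
      have e2 : swirl (fun y => U t y + a • eZ) x = swirl (u t) x := by simp only [swirl, hx]
      rw [e1, e2]
      exact hCsw t ht x
    have hcont : Continuous fun x => |swirl (U t) x| := (contDiff_swirl (hU1 t ht)).continuous.abs
    have h := SereginSverak2009.forall_le_of_ae_le_of_continuousOn isOpen_univ hcont.continuousOn
      continuousOn_const (by rwa [Measure.restrict_univ])
    exact fun x => h x (mem_univ x)
  -- far-field flattening of `U`, and of `u` (differences do not see the constants)
  obtain ⟨ρ, hρ⟩ := farField_velocity_osc_of_axisymmetric_add_drift hsolU hUM hUx hUt haxU hswU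
    hUwdiv hβm hβC R hR ε hε
  refine ⟨ρ, fun t ht x₀ hx₀ => ?_⟩
  obtain ⟨a, ha⟩ := hslice_u t ht
  filter_upwards [ha] with x hx
  filter_upwards [ha] with y hy
  intro hxb hyb
  rw [hx, hy, add_sub_add_right_eq_sub]
  exact hρ t ht x₀ hx₀ x hxb y hyb

/-- **Lei–Ren–Zhang 2019, Lemma 5.1, conjunct (i) as printed** (parabolic cubes
`Q_R(t₀, x₀) = B(x₀, R) × (t₀ − R², t₀)`, `t₀ ≤ 0`): the first conjunct of the named fact
`leiRenZhang2019_sliding`, for every bounded ancient mild solution with measurable axisymmetric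
slices and bounded swirl. [cite: LeiRenZhang2019, Lemma 5.1 (i) (arXiv p. 13)] -/
theorem leiRenZhang2019_sliding_velocity_cubes :
    ∀ u : ℝ → EuclideanSpace ℝ (Fin 3) → EuclideanSpace ℝ (Fin 3),
      IsBoundedAncientMildSolution 1 u →
      (∀ t < 0, AEStronglyMeasurable (u t) volume) →
        (∀ t < 0, IsAxisymmetric (u t)) →
          (∃ C : ℝ, ∀ t < 0, ∀ x, |swirl (u t) x| ≤ C) →
            ∀ R : ℝ, 0 < R → ∀ ε : ℝ, 0 < ε → ∃ ρ : ℝ, ∀ t₀ : ℝ, t₀ ≤ 0 →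
              ∀ x₀ : EuclideanSpace ℝ (Fin 3), ρ ≤ cylRadius x₀ →
                ∀ t ∈ Ioo (t₀ - R ^ 2) t₀,
                  ∀ᵐ x ∂(volume : Measure (EuclideanSpace ℝ (Fin 3))),
                    ∀ᵐ y ∂(volume : Measure (EuclideanSpace ℝ (Fin 3))),
                      x ∈ Metric.ball x₀ R → y ∈ Metric.ball x₀ R → ‖u t x - u t y‖ ≤ ε := by
  intro u hu hmeas haxi hswirl R hR ε hε
  obtain ⟨ρ, hρ⟩ := leiRenZhang2019_sliding_velocity hu hmeas haxi hswirl hR hε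
  exact ⟨ρ, fun t₀ ht₀ x₀ hx₀ t ht => hρ t (ht.2.trans_le ht₀) x₀ hx₀⟩

end Sliding

end Literature.Analysis.FluidPDE

end
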